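import Mathlib
import Summits.CriticalPhenomena.CardyFormulaZ2.Theorems.CardySelfRefinementDefs
import Summits.CriticalPhenomena.CardyFormulaZ2.Theorems.CardySelfRefinementGradientComparabilityStubSlopeBoundsCornerTransfer
import HarnessLib

/-!
# Crux `GradientComparability` (stmt-CriticalPhenomena-10269), line `monotone-product-coordinates` —
# stub `stub_cornerLocalSlope` (LOC), corner transfer (B″₂), part 4: summed over the far interior
# edges — `∂cP_far ≤ 18720/(1−c) · N_{S'}`

Route `CardySelfRefinement`, sub-problem `CriticalPhenomena/CardyFormulaZ2`; vocabulary from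
`CardySelfRefinementDefs` (`ax tb M Aloc edgeOf`); the per-edge corner transfer of part 3
(`real_isPivotal_interior_le_two`).

## Mathematics

Part 3 bounds, for `k = 2`, any real `ρ`, `0 ≤ c < 1`, the pivotality of a far non-axial edge
`edgeOf vd` by `585/(1−c)` times the set-pivotalities `M(PIV_B)` of the four side bundles of its cell
`z = tb 2 vd`, i.e. of the selectors `(z,0,2)`, `(z+e₀,1,2)`, `(z+e₁,0,2)`, `(z,1,2)`.  Here this is
summed over a finite set `VD` of such edges against any finite set `S'` of selector coins containing
these four selectors for every `vd ∈ VD` (`sum_real_isPivotal_interior_le_two`, registered):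

`Σ_{vd ∈ VD} M(edgeOf vd pivotal) ≤ 18720/(1−c) · Σ_{i ∈ S'} M(PIV_i)`,

`PIV_i = {ω ∪ B_i ∈ Aloc ∧ ω ∖ B_i ∉ Aloc}` the currency `N_{S'}` of the penalty half
`Drho_add_mul_Dc_ge_of_far`.  Bookkeeping: at most `8` labels `vd` share a cell
(`card_filter_tb_eq_le_eight`: `vd ↦ (vd.1 mod 2, vd.2)` is injective on a cell), and each of the
four side maps `z ↦ (side of z)` is injective, so every `PIV_i` is charged at most `4 · 8` times:
`18720 = 32 · 585`.  With `stub_Dc_eq_sum_pivotal` (`∂cP = Σ_{e ∈ Wn} M(e pivotal)`, `Wn` the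
non-axial window edges, in bijection with their labels `vd` by `edgeOf_injective`) this is the corner
transfer (B″₂) `∂cP_far ≤ C₂ N_{S'}` of the signed domination behind `stub_cornerLocalSlope`; the
non-far edges of `Wn` and the selectors of `S'` outside the far set are layer terms.
-/

noncomputable section

namespace Summit.CriticalPhenomena.CardyFormulaZ2.Theorems.CardySelfRefinement

open scoped Topology
open Filter Set MeasureTheory
open Literature.Probability.LatticeModels Literature.Probability.Percolation
open Literature.Probability.Percolation.QuadCrossing
open Summit.CriticalPhenomena.CardyFormulaZ2.Theses.CardySelfRefinement

/-! ## At most eight edge labels per cell -/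

/-- At most `8` labels `vd = (v, d)` have a given coarse base `tb 2 vd = z`
(`v ∈ 2z + {0,1}²`, `d ∈ {0,1}`): the map `vd ↦ (v₀ mod 2, v₁ mod 2, d)` is injective on them. -/
theorem card_filter_tb_eq_le_eight (VD : Finset (Site 2 × Fin 2)) (z : Site 2) :
    (VD.filter (fun vd => tb 2 vd = z)).card ≤ 8 := by
  classical
  set f : Site 2 × Fin 2 → ℤ × ℤ × Fin 2 := fun vd => (vd.1 0 % 2, vd.1 1 % 2, vd.2) with hf
  have hcard : (({0, 1} : Finset ℤ) ×ˢ (({0, 1} : Finset ℤ) ×ˢ (Finset.univ : Finset (Fin 2)))).card = 8 := by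
    rfl
  rw [← hcard]
  refine Finset.card_le_card_of_injOn f (fun vd _ => ?_) ?_
  · simp only [hf, Finset.coe_product, Finset.coe_insert, Finset.coe_singleton, Finset.coe_univ,
      Set.mem_prod, Set.mem_insert_iff, Set.mem_singleton_iff, Set.mem_univ, and_true]
    omega
  · rintro ⟨v, d⟩ hvd ⟨v', d'⟩ hvd' h
    simp only [Finset.coe_filter, Set.mem_setOf_eq] at hvd hvd'
    simp only [hf, Prod.mk.injEq] at h
    obtain ⟨h0, h1, rfl⟩ := h
    have e0 := congrFun hvd.2 0
    have e1 := congrFun hvd.2 1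
    have e0' := congrFun hvd'.2 0
    have e1' := congrFun hvd'.2 1
    simp only [tb, Nat.cast_ofNat] at e0 e1 e0' e1'
    refine Prod.ext (funext fun l => ?_) rfl
    fin_cases l
    · show v 0 = v' 0
      omega
    · show v 1 = v' 1
      omega

/-! ## The summed corner transfer -/

/-- **Corner transfer (B″₂), summed** (registered helper of `stub_cornerLocalSlope`).  For `k = 2`,
`0 < η`, `20η ≤ r`, any real `ρ`, `0 ≤ c < 1`, a finite set `VD` of NON-AXIAL labels `vd` whose
edges `edgeOf vd` have both ends drawn `r`-far from every side of every quad, and a finite set `S'`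
of coins containing, for every `vd ∈ VD` with cell `z = tb 2 vd`, the four side selectors
`(z,0,2)`, `(z+e₀,1,2)`, `(z+e₁,0,2)`, `(z,1,2)`:
`Σ_{vd ∈ VD} M_2(ρ,c)(edgeOf vd pivotal for Aloc) ≤ 18720/(1−c) · Σ_{i ∈ S'} M_2(ρ,c)(PIV_i)`,
`PIV_i = {ω ∪ B_i ∈ Aloc ∧ ω ∖ B_i ∉ Aloc}` (per-edge bound of part 3; each selector is a side of the
cells of at most `4 · 8` labels). -/
theorem sum_real_isPivotal_interior_le_two : ∀ (k m : ℕ), k = 2 → ∀ (F : Fin m → Quad (Set.univ : Set ℂ)) (η r : ℝ), 0 < η → 20 * η ≤ r → ∀ (ρ c : ℝ), c ∈ Set.Ico (0 : ℝ) 1 → ∀ (VD : Finset (Site 2 × Fin 2)), (∀ vd ∈ VD, ¬ ax k vd ∧ ∀ x ∈ edgeOf vd, ∀ (i : Fin m) (j : Fin 4), ∀ p ∈ (F i).side j, r ≤ dist ((η : ℂ) * squareLatticeEmbedding.z x) p) → ∀ (S' : Finset (Site 2 × Fin 2 × Fin 3)), (∀ vd ∈ VD, (tb k vd, (0 : Fin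 2), (2 : Fin 3)) ∈ S' ∧ (tb k vd + Pi.single 0 1, (1 : Fin 2), (2 : Fin 3)) ∈ S' ∧ (tb k vd + Pi.single 1 1, (0 : Fin 2), (2 : Fin 3)) ∈ S' ∧ (tb k vd, (1 : Fin 2), (2 : Fin 3)) ∈ S') → ∑ vd ∈ VD, (M k ρ c).real {ω | IsPivotal (Aloc m F η) (edgeOf vd) ω} ≤ 18720 / (1 - c) * ∑ i ∈ S', (M k ρ c).real {ω | ω ∪ edgeOf '' {vd : Site 2 × Fin 2 | ax k vd ∧ tb k vd = i.1 ∧ vd.2 = i.2.1} ∈ Aloc m F η ∧ ω \ edgeOf '' {vd : Site 2 × Fin 2 | ax k vd ∧ tb k vd = i.1 ∧ vd.2 = i.2.1} ∉ Aloc m F η} := by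
  intro k m hk F η r hη hηr ρ c hc VD hVD S' hS'
  classical
  subst hk
  set A : Set (BondConfig (Site 2)) := Aloc m F η with hA
  set Bs : Site 2 → Fin 2 → Set (Sym2 (Site 2)) :=
    fun t d => edgeOf '' {vd : Site 2 × Fin 2 | ax 2 vd ∧ tb 2 vd = t ∧ vd.2 = d} with hBs
  set g : Site 2 × Fin 2 × Fin 3 → ℝ := fun i => (M 2 ρ c).real {ω | ω ∪ Bs i.1 i.2.1 ∈ A ∧ ω \ Bs i.1 i.2.1 ∉ A}
    with hg
  have hg0 : ∀ i, 0 ≤ g i := fun i => measureReal_nonneg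
  -- the four side maps
  set σ₀ : Site 2 → Site 2 × Fin 2 × Fin 3 := fun t => (t, 0, 2) with hσ₀
  set σ₁ : Site 2 → Site 2 × Fin 2 × Fin 3 := fun t => (t + Pi.single 0 1, 1, 2) with hσ₁
  set σ₂ : Site 2 → Site 2 × Fin 2 × Fin 3 := fun t => (t + Pi.single 1 1, 0, 2) with hσ₂
  set σ₃ : Site 2 → Site 2 × Fin 2 × Fin 3 := fun t => (t, 1, 2) with hσ₃
  -- charging one side map: multiplicity at most `8`
  have step : ∀ σ : Site 2 → Site 2 × Fin 2 × Fin 3, Function.Injective σ → (∀ vd ∈ VD, σ (tb 2 vd) ∈ S') →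
      ∑ vd ∈ VD, g (σ (tb 2 vd)) ≤ 8 * ∑ i ∈ S', g i := by
    intro σ hσ hS
    rw [← Finset.sum_fiberwise_of_maps_to (g := fun vd => tb 2 vd) (t := VD.image (tb 2))
      (fun vd hvd => Finset.mem_image_of_mem _ hvd)]
    have hfib : ∀ t ∈ VD.image (tb 2), ∑ vd ∈ VD with tb 2 vd = t, g (σ (tb 2 vd)) ≤ 8 * g (σ t) := by
      intro t _
      rw [Finset.sum_congr rfl fun vd hvd => by rw [(Finset.mem_filter.1 hvd).2], Finset.sum_const, nsmul_eq_mul]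
      exact mul_le_mul_of_nonneg_right (by exact_mod_cast card_filter_tb_eq_le_eight VD t) (hg0 _)
    have hsub : (VD.image (tb 2)).image σ ⊆ S' := by
      intro i hi
      obtain ⟨t, ht, rfl⟩ := Finset.mem_image.1 hi
      obtain ⟨vd, hvd, rfl⟩ := Finset.mem_image.1 ht
      exact hS vd hvd
    calc ∑ t ∈ VD.image (tb 2), ∑ vd ∈ VD with tb 2 vd = t, g (σ (tb 2 vd))
        ≤ ∑ t ∈ VD.image (tb 2), 8 * g (σ t) := Finset.sum_le_sum hfib
      _ = 8 * ∑ i ∈ (VD.image (tb 2)).image σ, g i := by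
          rw [← Finset.mul_sum, Finset.sum_image fun x _ y _ h => hσ h]
      _ ≤ 8 * ∑ i ∈ S', g i :=
          mul_le_mul_of_nonneg_left (Finset.sum_le_sum_of_subset_of_nonneg hsub fun i _ _ => hg0 i) (by norm_num)
  have hinj₀ : Function.Injective σ₀ := fun a b h => (Prod.mk.inj h).1
  have hinj₁ : Function.Injective σ₁ := fun a b h => add_right_cancel (Prod.mk.inj h).1
  have hinj₂ : Function.Injective σ₂ := fun a b h => add_right_cancel (Prod.mk.inj h).1
  have hinj₃ : Function.Injective σ₃ := fun a b h => (Prod.mk.inj h).1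
  have h₀ := step σ₀ hinj₀ fun vd hvd => (hS' vd hvd).1
  have h₁ := step σ₁ hinj₁ fun vd hvd => (hS' vd hvd).2.1
  have h₂ := step σ₂ hinj₂ fun vd hvd => (hS' vd hvd).2.2.1
  have h₃ := step σ₃ hinj₃ fun vd hvd => (hS' vd hvd).2.2.2
  -- the per-edge bound, summed
  have hc1 : 0 < 1 - c := by linarith [hc.2]
  have hq : (0 : ℝ) ≤ 585 / (1 - c) := by positivity
  have hedge : ∀ vd ∈ VD, (M 2 ρ c).real {ω | IsPivotal A (edgeOf vd) ω} ≤
      585 / (1 - c) * (g (σ₀ (tb 2 vd)) + g (σ₁ (tb 2 vd)) + g (σ₂ (tb 2 vd)) + g (σ₃ (tb 2 vd))) := by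
    rintro ⟨v, d⟩ hvd
    exact real_isPivotal_interior_le_two 2 m rfl F η r hη hηr ρ c hc v d (hVD _ hvd).1 (hVD _ hvd).2
  calc ∑ vd ∈ VD, (M 2 ρ c).real {ω | IsPivotal A (edgeOf vd) ω}
      ≤ ∑ vd ∈ VD, 585 / (1 - c) * (g (σ₀ (tb 2 vd)) + g (σ₁ (tb 2 vd)) + g (σ₂ (tb 2 vd)) + g (σ₃ (tb 2 vd))) :=
        Finset.sum_le_sum hedge
    _ = 585 / (1 - c) * (∑ vd ∈ VD, g (σ₀ (tb 2 vd)) + ∑ vd ∈ VD, g (σ₁ (tb 2 vd)) +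
          ∑ vd ∈ VD, g (σ₂ (tb 2 vd)) + ∑ vd ∈ VD, g (σ₃ (tb 2 vd))) := by
        rw [← Finset.mul_sum]
        simp only [Finset.sum_add_distrib]
    _ ≤ 585 / (1 - c) * (8 * ∑ i ∈ S', g i + 8 * ∑ i ∈ S', g i + 8 * ∑ i ∈ S', g i + 8 * ∑ i ∈ S', g i) := by
        gcongr
    _ = 18720 / (1 - c) * ∑ i ∈ S', g i := by ring

end Summit.CriticalPhenomena.CardyFormulaZ2.Theorems.CardySelfRefinement

end
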